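import Mathlib.Analysis.Normed.Module.FiniteDimension
import Mathlib.Analysis.Normed.Module.RCLike.Real
import Mathlib.Analysis.Normed.Operator.BoundedLinearMaps
import Mathlib.Topology.Order.Compact
import HarnessLib

/-!
# The top Rayleigh quotient `sup_{w ≠ 0} B(w,w)/G(w,w)`: continuity and attainment

Coordinate language of the `MetricCoord` calculus: `B G : E → E →L[ℝ] E →L[ℝ] ℝ` are fields of
bilinear forms on a finite-dimensional real normed space `E` (in the application `B y` is the Ricci
form and `G y` the metric components at the chart point `y`, read in a chart as in O'Neill 1983,
Ch. 3, Prop. 3.59), and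

  `λ_max(y) := sup_{w ≠ 0} B_y(w,w) / G_y(w,w)`

is the top eigenvalue of `B y` relative to the positive definite form `G y` (the top Ricci
eigenvalue `λ_max(Ric)` of the elliptic Hamilton–Ivey estimate). By homogeneity the set of values
of the quotient over `{w ≠ 0}` is its set of values over the unit sphere of the norm of `E`
(`rayleighQuot_image_ne_zero_eq_image_sphere`), a compact set in finite dimension, so:

* `exists_rayleighSup_eq` — at a point where `G y` is positive definite (and `E ≠ 0`) the supremum
  is attained at some `v ≠ 0`, and `B_y(w,w) ≤ λ_max(y) · G_y(w,w)` for every `w`;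
* `continuousOn_rayleighSup` — `y ↦ λ_max(y)` is continuous on an open set on which `B`, `G` are
  continuous and `G` is positive definite (`IsCompact.continuous_sSup` over the unit sphere).

This is the `sup` companion of the `inf` version for `Ric(w,w)/(R |w|²)` in
`Literature/Geometry/Riemannian/RicciPinchingMinimum.lean`. Everything is proved; no definition is
introduced.

## References

* B. O'Neill, *Semi-Riemannian geometry*, Academic Press 1983, Ch. 3, Prop. 3.59 (tensors read in
  charts). [ONeill1983]
* R. S. Hamilton, *The formation of singularities in the Ricci flow*, Surveys in Differential
  Geometry II (1995), §24 (the Hamilton–Ivey pinching estimate). [Hamilton1995]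
-/

noncomputable section

open Set Filter Metric
open scoped Topology

namespace Literature.Geometry.Lorentzian.MetricCoord

variable {E : Type*} [NormedAddCommGroup E] [NormedSpace ℝ E] [FiniteDimensional ℝ E]

/-! ### The quotient of two quadratic forms: homogeneity and compactness of its values -/

omit [FiniteDimensional ℝ E] in
/-- **Homogeneity of the Rayleigh quotient**: over non-zero vectors the quotient `B(w,w)/G(w,w)` of
two quadratic forms takes the same values as over the unit sphere. [folklore] -/
theorem rayleighQuot_image_ne_zero_eq_image_sphere (B G : E →L[ℝ] E →L[ℝ] ℝ) :
    (fun w : E ↦ B w w / G w w) '' {w | w ≠ 0} =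
      (fun w : E ↦ B w w / G w w) '' sphere (0 : E) 1 := by
  ext r
  constructor
  · rintro ⟨w, hw, rfl⟩
    have hn : 0 < ‖w‖ := norm_pos_iff.mpr hw
    refine ⟨‖w‖⁻¹ • w, by simp [norm_smul, inv_mul_cancel₀ hn.ne'], ?_⟩
    simp only [map_smul, FunLike.coe_smul, Pi.smul_apply, smul_eq_mul]
    have hc : (‖w‖⁻¹ : ℝ) ≠ 0 := inv_ne_zero hn.ne'
    by_cases hden : G w w = 0
    · simp [hden]
    · field_simp
  · rintro ⟨w, hw, rfl⟩
    have hw0 : w ≠ 0 := by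
      rintro rfl
      simp at hw
    exact ⟨w, hw0, rfl⟩

/-- **Compactness of the values of the Rayleigh quotient** over the unit sphere of a
finite-dimensional space, for `G` positive definite (continuous image of a compact set).
[folklore] -/
theorem isCompact_rayleighQuot_image_sphere {B G : E →L[ℝ] E →L[ℝ] ℝ}
    (hpos : ∀ w : E, w ≠ 0 → 0 < G w w) :
    IsCompact ((fun w : E ↦ B w w / G w w) '' sphere (0 : E) 1) := by
  refine (isCompact_sphere (0 : E) 1).image_of_continuousOn ?_
  have hc1 : Continuous fun w : E ↦ B w w := B.continuous.clm_apply continuous_id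
  have hc2 : Continuous fun w : E ↦ G w w := G.continuous.clm_apply continuous_id
  refine hc1.continuousOn.div hc2.continuousOn fun w hw ↦ ?_
  have hw0 : w ≠ 0 := by
    rintro rfl
    simp at hw
  exact (hpos w hw0).ne'

/-- **The Rayleigh quotient is bounded by its supremum**: for `G` positive definite on a
finite-dimensional space, `B(w,w) ≤ (sup_{w' ≠ 0} B(w',w')/G(w',w')) · G(w,w)` for every `w`
(trivially for `w = 0`). [folklore] -/
theorem le_rayleighSup_mul {B G : E →L[ℝ] E →L[ℝ] ℝ} (hpos : ∀ w : E, w ≠ 0 → 0 < G w w)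
    (w : E) : B w w ≤ sSup ((fun w : E ↦ B w w / G w w) '' {w | w ≠ 0}) * G w w := by
  by_cases hw : w = 0
  · subst hw
    simp
  · have hle : B w w / G w w ≤ sSup ((fun w : E ↦ B w w / G w w) '' {w | w ≠ 0}) := by
      refine le_csSup ?_ ⟨w, hw, rfl⟩
      rw [rayleighQuot_image_ne_zero_eq_image_sphere]
      exact (isCompact_rayleighQuot_image_sphere hpos).bddAbove
    rwa [div_le_iff₀ (hpos w hw)] at hle

/-! ### Attainment and continuity of the supremum -/

/-- **The top Rayleigh quotient is attained**: at a point `y` where `G y` is positive definite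
(model space non-trivial), `sup_{w ≠ 0} B_y(w,w)/G_y(w,w)` is the value of the quotient at some
`v ≠ 0` (a maximum of a continuous function on the compact unit sphere), and
`B_y(w,w) ≤ λ_max(y) · G_y(w,w)` for every `w`. [folklore] -/
theorem exists_rayleighSup_eq {B G : E → E →L[ℝ] E →L[ℝ] ℝ} {y : E}
    (hpos : ∀ w : E, w ≠ 0 → 0 < G y w w) [Nontrivial E] :
    ∃ v : E, v ≠ 0 ∧ B y v v / G y v v = sSup ((fun w : E ↦ B y w w / G y w w) '' {w | w ≠ 0}) ∧
      ∀ w : E, B y w w ≤ sSup ((fun w : E ↦ B y w w / G y w w) '' {w | w ≠ 0}) * G y w w := by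
  have hsph : (sphere (0 : E) 1).Nonempty := NormedSpace.sphere_nonempty.mpr zero_le_one
  have hmem := (isCompact_rayleighQuot_image_sphere (B := B y) hpos).sSup_mem (hsph.image _)
  rw [← rayleighQuot_image_ne_zero_eq_image_sphere (B y) (G y)] at hmem
  obtain ⟨v, hv, hval⟩ := hmem
  exact ⟨v, hv, hval, le_rayleighSup_mul hpos⟩

/-- **Continuity of the fibre supremum over the unit sphere**: if `B`, `G` are continuous on `T`
and `G` is positive definite there, `y ↦ sup_{|w| = 1} B_y(w,w)/G_y(w,w)` is continuous on `T`
(`IsCompact.continuous_sSup` for the jointly continuous quotient on `T × sphere`). [folklore] -/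
theorem continuousOn_sSup_rayleighQuot_sphere {B G : E → E →L[ℝ] E →L[ℝ] ℝ} {T : Set E}
    (hB : ContinuousOn B T) (hG : ContinuousOn G T)
    (hpos : ∀ y ∈ T, ∀ w : E, w ≠ 0 → 0 < G y w w) :
    ContinuousOn (fun y ↦ sSup ((fun w : E ↦ B y w w / G y w w) '' sphere (0 : E) 1)) T := by
  -- jointly continuous quotient on `T × sphere`
  set f : T → sphere (0 : E) 1 → ℝ := fun y w ↦ B y (w : E) (w : E) / G y (w : E) (w : E)
    with hf
  have h2 : Continuous fun p : T × sphere (0 : E) 1 ↦ ((p.2 : sphere (0 : E) 1) : E) :=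
    continuous_subtype_val.comp continuous_snd
  have hBc : Continuous fun p : T × sphere (0 : E) 1 ↦ B p.1 (p.2 : E) (p.2 : E) := by
    have h1 : Continuous fun p : T × sphere (0 : E) 1 ↦ B p.1 :=
      hB.comp_continuous (continuous_subtype_val.comp continuous_fst) fun p ↦ p.1.2
    exact (h1.clm_apply h2).clm_apply h2
  have hGc : Continuous fun p : T × sphere (0 : E) 1 ↦ G p.1 (p.2 : E) (p.2 : E) := by
    have h1 : Continuous fun p : T × sphere (0 : E) 1 ↦ G p.1 :=
      hG.comp_continuous (continuous_subtype_val.comp continuous_fst) fun p ↦ p.1.2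
    exact (h1.clm_apply h2).clm_apply h2
  have hfc : Continuous ↿f := by
    refine hBc.div hGc fun p ↦ ?_
    have hw0 : (p.2 : E) ≠ 0 := by
      intro h
      have := p.2.2
      rw [mem_sphere_zero_iff_norm, h, norm_zero] at this
      exact zero_ne_one this
    exact (hpos _ p.1.2 _ hw0).ne'
  have hcont : Continuous fun y : T ↦ sSup (f y '' univ) := isCompact_univ.continuous_sSup hfc
  rw [continuousOn_iff_continuous_restrict]
  refine hcont.congr fun y ↦ ?_
  simp only [restrict_apply, hf, image_univ]
  congr 1
  ext r
  simp only [mem_range, mem_image, Subtype.exists, exists_prop]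

/-- **Continuity of the top Rayleigh quotient** `y ↦ λ_max(y) = sup_{w ≠ 0} B_y(w,w)/G_y(w,w)` on
an open set `T` on which `B`, `G` are continuous and `G` is positive definite: by homogeneity the
supremum is the supremum over the compact unit sphere, continuous in `y`
(`continuousOn_sSup_rayleighQuot_sphere`), and on an open set continuity is continuity at each
point. [folklore] -/
theorem continuousOn_rayleighSup {B G : E → E →L[ℝ] E →L[ℝ] ℝ} {T : Set E} (hT : IsOpen T)
    (hB : ContinuousOn B T) (hG : ContinuousOn G T) (hpos : ∀ y ∈ T, ∀ w : E, w ≠ 0 → 0 < G y w w)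
    [Nontrivial E] :
    ContinuousOn (fun y ↦ sSup ((fun w : E ↦ B y w w / G y w w) '' {w | w ≠ 0})) T := by
  refine hT.continuousOn_iff.mpr fun y₀ hy₀ ↦ ?_
  have h := (continuousOn_sSup_rayleighQuot_sphere hB hG hpos).continuousAt (hT.mem_nhds hy₀)
  refine h.congr (Eventually.of_forall fun y ↦ ?_)
  exact congrArg sSup (rayleighQuot_image_ne_zero_eq_image_sphere (B y) (G y)).symm

end Literature.Geometry.Lorentzian.MetricCoord

end
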